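import Summits.ResolutionOfSingularities.ResolutionOfSingularities.Theorems.PAlterationPicoverLocalBlowups
import Literature.AlgebraicGeometry.Resolution.BlowupsComposition
import Literature.AlgebraicGeometry.Resolution.ProOpenIdealExtension
import Literature.AlgebraicGeometry.Resolution.BlowupsFlatBaseChange
import HarnessLib

/-!
# Crux `AffineToGlobal` (stmt-ResolutionOfSingularities-15961), line `Sketch`: Temkin's localisation over the base

Route `ResolutionOfSingularities/SectionAscent`, crux `AffineToGlobal`, line `Sketch` (regular
yardsticks). Support file (`--supports stmt-ResolutionOfSingularities-15961`), registered stub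
`stub_regularBaseLocalization` of the lead's skeleton.

Temkin 2008, Prop. 2.3.4 (iii)⇒(ii) (localisation of desingularization), with the Noetherian
induction run over the BASE `R` while the scheme being desingularized is a blow-up
`π : M → R` of `R`: if for every `x ∈ R` every blow-up of the local scheme `Spec 𝒪_{R,x}` whose
singular points lie over the closed point admits a desingularization, then every blow-up `M`
of the integral `K`-variety `R` admits a desingularization.

The proof is the in-tree induction of
`Picover.LocalBlowups.admitsDesingularization_of_localBlowups`
(`Theorems/PAlterationPicoverLocalBlowups.lean`; = `temkin2008_prop234_of_comp` of
`Literature/AlgebraicGeometry/Resolution/Temkin2008LocalizationProofs.lean`) on the closed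
subset `C ⊆ R` over which the current `Sing M`-supported blow-up `f : X' → M` is still
singular. The structure map `f ≫ π : X' → R` is again a blow-up of the Noetherian scheme `R`
(Stacks 080B, `IsBlowup.exists_isBlowup_comp`), so its flat base change to `Spec 𝒪_{R,x}`, `x` a
maximal point of `C`, is a blow-up of the local scheme, singular only over the closed point; the
hypothesis desingularizes it; the centre extends to `X'` (Temkin's Lemma 2.1.1,
`exists_idealSheaf_extension_fromSpecStalk`) with support over `Sing M` because `f` is an
isomorphism off its `Sing M`-supported centre; the composite is a `Sing M`-supported blow-up of
`M` (Lemma 2.1.4, `IsBlowup.exists_isBlowup_comp_supported`), regular over `R ∖ C` and over `x`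
(flat base change and uniqueness of blow-ups), so the new bad closed set is `< C`.

No new definitions; no statement item is restated. [cite: Temkin2008, Prop. 2.3.4]
[cite: StacksProject, Tag 080B]
-/

noncomputable section

set_option linter.dupNamespace false -- mandated namespace of this single-conjunct summit

open CategoryTheory CategoryTheory.Limits AlgebraicGeometry TopologicalSpace IsLocalRing
open Literature.AlgebraicGeometry.Resolution

namespace Summit.ResolutionOfSingularities.ResolutionOfSingularities.Theorems.AffineToGlobal.RegularBaseLocalization

/-- **Temkin's localisation over the base, for blow-ups of the base** (stub
`stub_regularBaseLocalization` of line `Sketch`; Temkin 2008, Prop. 2.3.4 (iii)⇒(ii), the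
Noetherian induction run over `R`). Let `R` be an integral scheme of finite type over a field
`K`. If for every `x ∈ R` every blow-up `S'` of `Spec 𝒪_{R,x}` whose singular points all lie
over the closed point admits a desingularization, then every blow-up `π : M → R` of `R` admits
a desingularization. Proof: Noetherian induction on the closed subset `C ⊆ R` over which the
current `Sing M`-supported blow-up `f : X' → M` is still singular; `f ≫ π` is a blow-up of `R`
(Stacks 080B), its flat base change to `Spec 𝒪_{R,x}` (`x` a maximal point of `C`) is
desingularized by hypothesis, the centre extends to `X'` (Temkin's Lemma 2.1.1) with support
over `Sing M` (`f` is an isomorphism off its centre), the composite is a `Sing M`-supported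
blow-up of `M` (Lemma 2.1.4), and the new singular image in `R` is a closed subset `< C`.
[cite: Temkin2008, Prop. 2.3.4] [cite: StacksProject, Tag 080B] -/
theorem stub_regularBaseLocalization (K : Type) [Field K] (R : Scheme.{0}) [IsIntegral R]
    (fR : R ⟶ Spec (.of K)) [LocallyOfFiniteType fR] [QuasiCompact fR]
    (hloc : ∀ (x : R) (S' : Scheme.{0}) (g : S' ⟶ Spec (R.presheaf.stalk x))
      (I : (Spec (R.presheaf.stalk x)).IdealSheafData), IsBlowup g I →
      (∀ s : S', s ∉ Scheme.regularLocus S' → g s = closedPoint (R.presheaf.stalk x)) →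
      Scheme.AdmitsDesingularization S')
    (M : Scheme.{0}) (π : M ⟶ R) (J : R.IdealSheafData) (hπ : IsBlowup π J) :
    Scheme.AdmitsDesingularization M := by
  -- the base field is Noetherian and quasi-excellent; `R` is a Noetherian scheme
  haveI : IsNoetherianRing (CommRingCat.of K) := inferInstanceAs (IsNoetherianRing K)
  haveI : IsNoetherian (Spec (CommRingCat.of K)) := {}
  have hqe : Scheme.IsQuasiExcellent (Spec (CommRingCat.of K)) :=
    Scheme.isQuasiExcellent_of_locallyOfFiniteType_of_isQuasiExcellentRing Stacks07QU_holds
      (isQuasiExcellentRing_of_field K) (𝟙 _)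
  haveI : IsLocallyNoetherian R := LocallyOfFiniteType.isLocallyNoetherian fR
  haveI : CompactSpace R := QuasiCompact.compactSpace_of_compactSpace fR
  haveI : IsNoetherian R := {}
  -- `M` is proper over `R`: a Noetherian scheme of finite type over `K`, with closed singular
  -- locus `T`
  haveI : IsProper π := hπ.isProper
  haveI : IsLocallyNoetherian M := LocallyOfFiniteType.isLocallyNoetherian π
  haveI : CompactSpace M := QuasiCompact.compactSpace_of_compactSpace π
  haveI : IsNoetherian M := {}
  set T : Set M := (Scheme.regularLocus M)ᶜ with hT
  have hTc : IsClosed T := isClosed_compl_regularLocus_of_locallyOfFiniteType (π ≫ fR) hqe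
  -- the induction statement, over the closed subsets `C` of the base `R`
  suffices H : ∀ C : Closeds R,
      (∃ (X' : Scheme.{0}) (f : X' ⟶ M) (P : M.IdealSheafData), IsBlowup f P ∧
        (P.support : Set M) ⊆ T ∧ ∀ x' : X', π (f x') ∉ C → x' ∈ Scheme.regularLocus X') →
      Scheme.AdmitsDesingularization M by
    refine H ⊤ ⟨M, 𝟙 M, ⊤, isBlowup_id_top M, ?_, fun x' hx' => absurd trivial hx'⟩
    simp [Scheme.IdealSheafData.support_top]
  intro C
  induction C using WellFoundedLT.induction with
  | ind C ih =>
  intro ⟨X', f, P, hf, hP, hreg⟩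
  -- either `X'` is already regular …
  by_cases hall : ∀ x' : X', x' ∈ Scheme.regularLocus X'
  · exact ⟨X', f, ⟨P, hf, hP⟩, fun x' => (Scheme.mem_regularLocus x').mp (hall x')⟩
  -- … or some point of `X'` is singular, hence lies over `C`; pick a maximal point `x` of `C`
  push Not at hall
  obtain ⟨x₁, hx₁⟩ := hall
  have hx₁C : π (f x₁) ∈ (C : Set R) := by
    by_contra h
    exact hx₁ (hreg x₁ h)
  obtain ⟨x, hxC, hmax⟩ := exists_maximal_point_of_isClosed C.isClosed hx₁C
  -- `X'` is Noetherian, and its structure map `f ≫ π : X' → R` is a blow-up of `R` (Stacks 080B)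
  haveI : IsProper f := hf.isProper
  haveI : IsLocallyNoetherian X' := LocallyOfFiniteType.isLocallyNoetherian f
  haveI : CompactSpace X' := QuasiCompact.compactSpace_of_compactSpace f
  haveI : IsNoetherian X' := {}
  obtain ⟨Q, hρ, -⟩ := hπ.exists_isBlowup_comp hf
  -- the singular locus of `X'` lies over `T`: `f` is an isomorphism off `Supp P ⊆ T`
  have hX'T : (Scheme.regularLocus X')ᶜ ⊆ f ⁻¹' T := by
    intro x' hx'
    by_contra hT'
    have hfx' : f x' ∈ Scheme.regularLocus M := by simpa [hT] using hT'
    have h2 : f x' ∉ (P.support : Set M) := fun h => hT' (hP h)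
    haveI := hf.isIso_compl
    exact hx' ((mem_regularLocus_iff_of_isIso_morphismRestrict f
      ⟨(P.support : Set M)ᶜ, P.support.isClosed.isOpen_compl⟩ x' h2).mpr hfx')
  -- the local scheme `S = Spec 𝒪_{R,x}` and the pro-open pro-subscheme `S' = X' ×_R S` of `X'`,
  -- a blow-up of `S` (flat base change)
  haveI : Flat (R.fromSpecStalk x) := flat_fromSpecStalk R x
  haveI : IsNoetherian (pullback (f ≫ π) (R.fromSpecStalk x)) := {}
  have hgb : IsBlowup (pullback.snd (f ≫ π) (R.fromSpecStalk x))
      (Q.comap (R.fromSpecStalk x)) :=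
    hρ.pullback_snd_of_flat (R.fromSpecStalk x)
  have hfj : ∀ s : ↑(pullback (f ≫ π) (R.fromSpecStalk x)),
      π (f (pullback.fst (f ≫ π) (R.fromSpecStalk x) s)) =
        R.fromSpecStalk x (pullback.snd (f ≫ π) (R.fromSpecStalk x) s) := fun s => by
    rw [← Scheme.Hom.comp_apply, ← Scheme.Hom.comp_apply, pullback.condition,
      Scheme.Hom.comp_apply]
  -- `S'_sing ⊆ g⁻¹(s)`: a singular point of `S'` is singular in `X'`, hence lies over `C`, over a
  -- generization of `x`, hence over `x` by maximality
  have hsing : ∀ s : ↑(pullback (f ≫ π) (R.fromSpecStalk x)),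
      s ∉ Scheme.regularLocus (pullback (f ≫ π) (R.fromSpecStalk x)) →
        pullback.snd (f ≫ π) (R.fromSpecStalk x) s = closedPoint (R.presheaf.stalk x) := by
    intro s hs
    have h1 : pullback.fst (f ≫ π) (R.fromSpecStalk x) s ∉ Scheme.regularLocus X' := fun h =>
      hs ((mem_regularLocus_iff_pullback_fst_fromSpecStalk (f ≫ π) x s).mpr h)
    have h2 : π (f (pullback.fst (f ≫ π) (R.fromSpecStalk x) s)) ∈ (C : Set R) := by
      by_contra h
      exact h1 (hreg _ h)
    have h3 : R.fromSpecStalk x (pullback.snd (f ≫ π) (R.fromSpecStalk x) s) ⤳ x :=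
      Scheme.range_fromSpecStalk.le ⟨_, rfl⟩
    have h4 : R.fromSpecStalk x (pullback.snd (f ≫ π) (R.fromSpecStalk x) s) = x :=
      hmax _ (hfj s ▸ h2) h3
    apply (R.fromSpecStalk x).isEmbedding.injective
    rw [h4, Scheme.fromSpecStalk_closedPoint]
  -- the local desingularization provided by the hypothesis at `x`
  obtain ⟨S'', g', hdes⟩ := hloc x (pullback (f ≫ π) (R.fromSpecStalk x))
    (pullback.snd (f ≫ π) (R.fromSpecStalk x)) (Q.comap (R.fromSpecStalk x)) hgb hsing
  obtain ⟨I', hg', hI'⟩ := hdes.exists_isBlowup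
  have hS''reg := hdes.isRegular
  -- extend its centre to `X'` (Temkin's Lemma 2.1.1) and blow `X'` up along the extension
  obtain ⟨J', hJ'I', hJ'supp⟩ := exists_idealSheaf_extension_fromSpecStalk (f ≫ π) x I'
  obtain ⟨X'', f', hf'⟩ := exists_isBlowup X' J'
  -- the points of the local centre lie over `x ∈ C` …
  have hIx : ∀ s ∈ (I'.support : Set ↑(pullback (f ≫ π) (R.fromSpecStalk x))),
      π (f (pullback.fst (f ≫ π) (R.fromSpecStalk x) s)) = x := fun s hs => by
    rw [hfj, hsing s (hI' hs), Scheme.fromSpecStalk_closedPoint]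
  have hJ'C : ∀ x' ∈ (J'.support : Set X'), π (f x') ∈ (C : Set R) := by
    have key : (f ≫ π) '' (J'.support : Set X') ⊆ (C : Set R) := by
      rw [hJ'supp]
      refine (image_closure_subset_closure_image (f ≫ π).continuous).trans ?_
      refine C.isClosed.closure_subset_iff.mpr ?_
      rintro _ ⟨_, ⟨s, hs, rfl⟩, rfl⟩
      rw [Scheme.Hom.comp_apply, hIx s hs]
      exact hxC
    exact fun x' hx' => key ⟨x', hx', rfl⟩
  -- … and are singular in `X'`, so the new centre lies over `T` (`f ⁻¹ T` is closed)
  have hJ'T : (J'.support : Set X') ⊆ f ⁻¹' T := by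
    rw [hJ'supp]
    refine (hTc.preimage f.continuous).closure_subset_iff.mpr ?_
    rintro _ ⟨s, hs, rfl⟩
    exact hX'T fun h =>
      hI' hs ((mem_regularLocus_iff_pullback_fst_fromSpecStalk (f ≫ π) x s).mpr h)
  -- so the composite is a `T`-supported blow-up of `M` (Temkin's Lemma 2.1.4)
  obtain ⟨P₂, hf₂, hP₂⟩ := hf.exists_isBlowup_comp_supported f P f' J' T hP hf' hJ'T
  -- `X''` is of finite type over `K`: its singular locus is closed, with closed image `C'` in `R`
  haveI : IsProper f' := hf'.isProper
  have hreg'' : IsClosed (Scheme.regularLocus X'')ᶜ :=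
    isClosed_compl_regularLocus_of_locallyOfFiniteType (((f' ≫ f) ≫ π) ≫ fR) hqe
  let C' : Closeds R :=
    ⟨((f' ≫ f) ≫ π) '' (Scheme.regularLocus X'')ᶜ, ((f' ≫ f) ≫ π).isClosedMap _ hreg''⟩
  -- `C' ⊆ C ∖ {x}`
  have hC'C : (C' : Set R) ⊆ (C : Set R) \ {x} := by
    rintro _ ⟨x'', hx'', rfl⟩
    refine ⟨?_, ?_⟩
    · -- over `R ∖ C`: `X'` is regular there and `f'` is an isomorphism off its centre
      by_contra hy
      have hy' : π (f (f' x'')) ∉ (C : Set R) := by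
        rwa [Scheme.Hom.comp_apply, Scheme.Hom.comp_apply] at hy
      have h1 : f' x'' ∈ Scheme.regularLocus X' := hreg _ hy'
      have h2 : f' x'' ∉ (J'.support : Set X') := fun h => hy' (hJ'C _ h)
      haveI := hf'.isIso_compl
      exact hx'' ((mem_regularLocus_iff_of_isIso_morphismRestrict f'
        ⟨(J'.support : Set X')ᶜ, J'.support.isClosed.isOpen_compl⟩ x'' h2).mpr h1)
    · -- over `x`: `X'' ×_{X'} S'` is the regular scheme `S''` (flat base change, uniqueness)
      intro hyx
      rw [Set.mem_singleton_iff, Scheme.Hom.comp_apply, Scheme.Hom.comp_apply,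
        ← Scheme.Hom.comp_apply] at hyx
      obtain ⟨s, hs⟩ := mem_range_pullback_fst_fromSpecStalk_of_eq (f ≫ π) x hyx
      have hT' : IsBlowup (pullback.snd f' (pullback.fst (f ≫ π) (R.fromSpecStalk x))) I' := by
        rw [← hJ'I']
        exact hf'.pullback_snd_of_flat _
      obtain ⟨e, -, -⟩ := hT'.unique hg'
      have hx''range :
          x'' ∈ Set.range (pullback.fst f' (pullback.fst (f ≫ π) (R.fromSpecStalk x))) := by
        rw [Scheme.Pullback.range_fst]
        exact ⟨s, hs⟩
      obtain ⟨t, rfl⟩ := hx''range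
      apply hx''
      refine (mem_regularLocus_iff_of_flat_of_isPreimmersion _ t).mp ?_
      exact (mem_regularLocus_iff_of_flat_of_isPreimmersion e.hom t).mpr (hS''reg _)
  have hlt : C' < C := by
    refine lt_of_le_of_ne (fun y hy => (hC'C hy).1) fun h => ?_
    have hx' : x ∈ (C' : Set R) := by
      rw [h]
      exact hxC
    exact (hC'C hx').2 rfl
  exact ih C' hlt
    ⟨X'', f' ≫ f, P₂, hf₂, hP₂, fun x'' hx'' => by
      by_contra h
      exact hx'' ⟨x'', h, rfl⟩⟩

end Summit.ResolutionOfSingularities.ResolutionOfSingularities.Theorems.AffineToGlobal.RegularBaseLocalization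

end
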